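import Summits.BirchSwinnertonDyer.Rank1Residual.X1.RankOne
import Summits.BirchSwinnertonDyer.Rank1Residual.X1.RankZeroPartner
import Literature.NumberTheory.EllipticCurves.Rank1Residual.ClassX1KellerYinRankOneReduction
import HarnessLib

/-!
# Residual class X1 ∩ {r = 1}: the Keller–Yin route keyed to the leaf, the two routes combined, and
# the covered neighbours at analytic rank one

HONEST FRAMING (cell `b2b-bsdres`, run/shared/lean/b2b/bsd-rank1-residual/, verbatim in every
file): the goal of the cell is to DELETE the COMBINATION-SHAPED residual classes of the
Birch–Swinnerton-Dyer formula for ALL analytic-rank `≤ 1` elliptic curves over `ℚ` — "full BSD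
formula for every rank `≤ 1` curve in class `C`" assembled STRICTLY from published theorems — so
that the rank-`≤ 1` remainder becomes exactly the CONSTRUCTION-SHAPED classes, which are TYPED
(missing-input `Prop`s), NOT attempted. This is not "finishing BSD". CLASS-OWNERS.md (2026-08-20):
row "X1 (r = 1)" — research route; NO CLAIM BEYOND STATED CLASSES; no label change. The announced
preprint Keller–Yin arXiv:2402.12781v2 enters ONLY as an explicitly labelled OPEN hypothesis
(`KellerYin2024.thm421_rankOne_display_OPEN`, `RankZeroPartner.RankZeroDisplay`).

Unit `b2b-bsdres-x1a` (X1 prover A, gen 9). Sequel of the statement file `X1/RankOne.lean` (`Leaf`,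
`Statement`, `SchneiderOnLeaf`; route B = cyclotomic keyed there). Theorems only, keyed BY NAME to
decls landed by the x1a / x1b / eisenstein-p1 seats; nothing asserted.

* §1 ROUTE A (anticyclotomic; x1a gens 1–2; Keller–Yin PREPRINT): `Leaf.bsdp_of_not_gvPar_of_KY`
  (A1 = X1a ⇐ `KellerYin2024.thm421_rankOne_display_OPEN` ALONE + published facts: the admissible
  twist is of type B and rank `0`, covered row C7), `Leaf.bsdp_of_KY_of_rankZeroStatement` /
  `statement_of_KY_of_rankZeroStatement` (the whole leaf ⇐ the display + `RankZero.Statement`: a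
  type-B curve's partner is a rank-`0` LEAF pair), `bsdpOnClassX1_iff_rankZeroStatement_of_KY`
  (granted the preprint, class X1 IS its rank-zero leaf).
* §2 THE TWO ROUTES COMBINED (new bookkeeping, gen 9): `statement_of_KY_of_schneider_typeB` — the
  rank-one leaf ⇐ Keller–Yin's display on type A + Schneider certificates on type B + PUBLISHED facts,
  with NO unstated main conjecture; and `bsdpOnClassX1_of_KY_of_rankZeroDisplay_of_schneider` — THE
  WHOLE CLASS X1 ⇐ Keller–Yin's STATED Thms. 3.0.11 + 7.0.6 in both rank configurations
  (`thm421_rankOne_display_OPEN`, eisenstein-p1's `RankZeroDisplay`) + Schneider certificates at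
  rank-one TYPE-B pairs only (B1 itself, and one admissible B1-partner of each rank-`0` leaf pair,
  eisenstein-p1's route H) + published facts. I.e. modulo per-pair finite certificates on type-B
  rank-one curves, class X1 is conditional on the two announced Keller–Yin theorems and on NOTHING
  unstated (compare `Rank1ResidualX1Defs.bsdpOnClassX1_of_typedInputs'`: KY display +
  `MazurMainConjectureOnX1TypeA`, the latter unstated in print).
* §3 the covered neighbour at `r = 1` (`bsdp_of_not_leaf` = C6, Castella–Grossi–Skinner 2025 Thm. D:
  at `r = 1`, "good, reducible, `p > 2`, off the leaf" means NOT anomalous), the rank-one dichotomy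
  `bsdp_or_leaf`, and `bsdp_goodEisenstein_of_statements`: the two leaf statements settle EVERY good
  Eisenstein prime `p > 2` of every elliptic curve over `ℚ` of analytic rank `≤ 1`.

References: RESIDUAL-CASES.md §a.2 X1; PARTITION.md §3 row 18; [KellerYin2024] Thms. 3.0.11, 7.0.6,
4.2.1 (PRE); [CastellaEtAl2021] Thms. 5.1.4, 5.3.1; [GreenbergVatsal2000] Thm. (1.3);
[CastellaGrossiSkinner2025] Thm. D; [GreenbergLNM1716] Thm. 4.1; [PerrinRiou1987] §1.4;
[Schneider1985]; [Miller2011LMS] Def. 1.1.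
-/

noncomputable section

open scoped Classical MatrixGroups ModularForm

open CongruenceSubgroup WeierstrassCurve Literature.NumberTheory.EllipticCurves
  Literature.NumberTheory.EllipticCurves.ModularForms
  Literature.NumberTheory.EllipticCurves.Rank1Residual
  Summit.BirchSwinnertonDyer.BirchSwinnertonDyer.Theorems
  Summit.BirchSwinnertonDyer.BirchSwinnertonDyer.Theorems.Rank1ResidualX1Defs
  Summit.BirchSwinnertonDyer.BirchSwinnertonDyer.Theorems.Rank1ResidualX1Converse

set_option autoImplicit false

namespace Summit.BirchSwinnertonDyer.Rank1Residual.X1.RankOne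

variable {W : WeierstrassCurve ℚ} [W.IsGloballyMinimal] {p : ℕ} [Fact p.Prime]

/-! ### §1. Route A (anticyclotomic): Keller–Yin's announced display (PREPRINT, explicit hypothesis) -/

/-- **A1 (= X1a) ⇐ Keller–Yin's rank-one display ALONE, plus PUBLISHED facts** (x1a gen 1): at a leaf
pair of type A (`¬ GVPar W p`), `BSD(E,p)` follows from `KellerYin2024.thm421_rankOne_display_OPEN`
(`hKY`; OPEN: Keller–Yin Thms. 3.0.11 + 7.0.6, arXiv:2402.12781v2, with the published links
Gross–Zagier, BDP, Kolyvagin, [CGLS] (5.5)–(5.7)) and Greenberg–Vatsal 2000 (`hGV`; the admissible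
twist `E^K` is of type B and rank `0`: covered row C7), Greenberg Thm. 4.1 (`hGr`), modularity (`hmod`,
`hmod'`), Hoffstein–Luo 1997 (`hHL`), Gross–Zagier I.7.3 (`hGZ`), GZK (`hGZK`). No certificate, no
unstated main conjecture. [cite: KellerYin2024, Thm. 4.2.1 and its proof (p. 22) (announced; explicit hypothesis)]
[cite: GreenbergVatsal2000, Thm. (1.3)] [cite: CastellaEtAl2021, Thms. 5.1.4, 5.3.1] -/
theorem Leaf.bsdp_of_not_gvPar_of_KY [W.IsElliptic] (hKY : KellerYin2024.thm421_rankOne_display_OPEN)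
    (hGV : GreenbergVatsal2000.thm13_charIdeal_eq_of_gvPar) (hGr : greenberg_charValue_rankZero)
    (hmod : nonempty_modularParametrizationData) (hmod' : exists_isNewformOf)
    (hHL : HoffsteinLuo1997_exists_twist_L_one_ne_zero) (hGZ : GrossZagier1986_thm_I_7_3)
    (hGZK : rank_eq_analyticRank_of_analyticRank_le_one) (h : Leaf W p) (hA : ¬ GVPar W p) :
    BSDp W p :=
  Rank1ResidualX1Defs.bsdp_of_classX1_typeA_of_analyticRank_eq_one hKY hGV hGr hmod hmod' hHL hGZ hGZK
    W p h.1 hA h.2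

/-- **The whole rank-one leaf ⇐ Keller–Yin's display + the RANK-ZERO leaf statement** (x1a gen 2,
`ClassX1KellerYinRankOneReduction`): at a leaf pair of either type, the admissible twist `E^K` is a
rank-`0` curve which is of type B (Greenberg–Vatsal, published) or a rank-`0` LEAF pair at the same
prime, where `RankZero.Statement` (`h0`) supplies `BSD(E^K,p)`. So, granted the preprint, the rank-one
leaf carries NO residue of its own beyond the rank-zero leaf.
[cite: KellerYin2024, Thm. 4.2.1 and its proof (p. 22) (announced; explicit hypothesis)]
[cite: CastellaEtAl2021, Thms. 5.1.4, 5.3.1] [cite: GreenbergVatsal2000, Thm. (1.3)] -/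
theorem Leaf.bsdp_of_KY_of_rankZeroStatement [W.IsElliptic]
    (hKY : KellerYin2024.thm421_rankOne_display_OPEN) (h0 : RankZero.Statement)
    (hGV : GreenbergVatsal2000.thm13_charIdeal_eq_of_gvPar) (hGr : greenberg_charValue_rankZero)
    (hmod : nonempty_modularParametrizationData) (hmod' : exists_isNewformOf)
    (hHL : HoffsteinLuo1997_exists_twist_L_one_ne_zero) (hGZ : GrossZagier1986_thm_I_7_3)
    (hGZK : rank_eq_analyticRank_of_analyticRank_le_one) (h : Leaf W p) : BSDp W p :=
  Rank1Residual.bsdp_of_classX1_of_analyticRank_eq_one_of_KY_OPEN_of_bsdp_rankZero hGV hGr hmod hmod'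
    hHL hGZ hGZK hKY W p h.1 h.2 (fun W' _ _ hX1' hr0 ↦ h0 W' p ⟨hX1', hr0⟩)

/-- **Route A at class level: `RankZero.Statement` + Keller–Yin ⇒ `Statement`.**
[cite: KellerYin2024, Thm. 4.2.1 and its proof (p. 22) (announced; explicit hypothesis)]
[cite: CastellaEtAl2021, Thms. 5.1.4, 5.3.1] -/
theorem statement_of_KY_of_rankZeroStatement (hKY : KellerYin2024.thm421_rankOne_display_OPEN)
    (h0 : RankZero.Statement)
    (hGV : GreenbergVatsal2000.thm13_charIdeal_eq_of_gvPar) (hGr : greenberg_charValue_rankZero)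
    (hmod : nonempty_modularParametrizationData) (hmod' : exists_isNewformOf)
    (hHL : HoffsteinLuo1997_exists_twist_L_one_ne_zero) (hGZ : GrossZagier1986_thm_I_7_3)
    (hGZK : rank_eq_analyticRank_of_analyticRank_le_one) : Statement :=
  fun _ _ _ _ _ h ↦ h.bsdp_of_KY_of_rankZeroStatement hKY h0 hGV hGr hmod hmod' hHL hGZ hGZK

/-- **Granted Keller–Yin, class X1 IS its rank-zero leaf:** `BSDpOnClassX1 ↔ RankZero.Statement`
(x1a `bsdpOnClassX1_iff_rankZero_of_KY` re-keyed). [cite: KellerYin2024, Thm. 4.2.1 (p. 22) (announced; explicit hypothesis)] -/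
theorem bsdpOnClassX1_iff_rankZeroStatement_of_KY (hKY : KellerYin2024.thm421_rankOne_display_OPEN)
    (hGV : GreenbergVatsal2000.thm13_charIdeal_eq_of_gvPar) (hGr : greenberg_charValue_rankZero)
    (hmod : nonempty_modularParametrizationData) (hmod' : exists_isNewformOf)
    (hHL : HoffsteinLuo1997_exists_twist_L_one_ne_zero) (hGZ : GrossZagier1986_thm_I_7_3)
    (hGZK : rank_eq_analyticRank_of_analyticRank_le_one) : BSDpOnClassX1 ↔ RankZero.Statement :=
  (bsdpOnClassX1_iff_rankZero_of_KY hKY hGV hGr hmod hmod' hHL hGZ hGZK).trans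
    RankZero.statement_iff_classForm.symm

/-! ### §2. The two routes combined: no unstated input, certificates on type B only -/

/-- **The rank-one leaf from Keller–Yin on type A and Schneider certificates on type B — NO unstated
main conjecture.** Granted `KellerYin2024.thm421_rankOne_display_OPEN` (`hKY`, PREPRINT, explicit),
Schneider's non-degeneracy at every TYPE-B leaf pair (`hSchB`; per pair a finite certificate) and the
PUBLISHED named facts (Greenberg–Vatsal `hGV`, Greenberg 4.1 `hGr`, Perrin-Riou–Schneider `hS`,
Perrin-Riou 1987 `hPR`, Mazur–Tate sigma `hMT`, modularity `hmod`/`hmod'`, Hoffstein–Luo `hHL`,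
Gross–Zagier I.7.3 `hGZ`, GZK `hGZK`): `Statement`. Type A by route A (`Leaf.bsdp_of_not_gvPar_of_KY`),
type B by route B (`Leaf.bsdp_of_gvPar_of_schneider`). Census: the 37 B1 pairs (`N < 2·10⁴`) all
carry a two-engine certificate value (x1a X1-CHAIN §12; uncertified by the lane).
[cite: KellerYin2024, Thm. 4.2.1 and its proof (p. 22) (announced; explicit hypothesis)]
[cite: GreenbergVatsal2000, Thm. (1.3)] [cite: PerrinRiou1987, §1.4 Cor. 1.8] -/
theorem statement_of_KY_of_schneider_typeB (hKY : KellerYin2024.thm421_rankOne_display_OPEN)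
    (hSchB : ∀ (W : WeierstrassCurve ℚ) [W.IsElliptic] [W.IsGloballyMinimal] (p : ℕ) [Fact p.Prime],
      Leaf W p → GVPar W p → ∀ Dh : PAdicHeightData W p, Dh.IsCanonical → SchneiderConjecture Dh)
    (hGV : GreenbergVatsal2000.thm13_charIdeal_eq_of_gvPar) (hGr : greenberg_charValue_rankZero)
    (hS : Schneider1985_order_charGenerator_odd) (hPR : perrinRiou_rankOne_leadingTerms_odd)
    (hMT : mazur_tate_sigma_exists_odd) (hmod : nonempty_modularParametrizationData)
    (hmod' : exists_isNewformOf) (hHL : HoffsteinLuo1997_exists_twist_L_one_ne_zero)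
    (hGZ : GrossZagier1986_thm_I_7_3) (hGZK : rank_eq_analyticRank_of_analyticRank_le_one) :
    Statement := by
  intro W _ _ p _ h
  by_cases hB : GVPar W p
  · exact h.bsdp_of_gvPar_of_schneider hGV hS hPR hMT hmod hGZK hB (hSchB W p h hB)
  · exact h.bsdp_of_not_gvPar_of_KY hKY hGV hGr hmod hmod' hHL hGZ hGZK hB

/-- **THE WHOLE CLASS X1 MODULO THE PREPRINT AND RANK-ONE TYPE-B CERTIFICATES.** Granted Keller–Yin's
STATED Theorems 3.0.11 (anticyclotomic IMC at an ordinary Eisenstein prime) and 7.0.6 (control with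
torsion) in BOTH rank configurations — the rank-one display `KellerYin2024.thm421_rankOne_display_OPEN`
(`hKY`) and its mirror `RankZeroPartner.RankZeroDisplay` (`hDisp`), PREPRINT, explicit hypotheses —
the typed class target `BSDpOnClassX1` follows from Schneider certificates at rank-one TYPE-B pairs
ONLY: at the B1 leaf pairs themselves (`hSchB`) and at one admissible B1-partner of each rank-zero leaf
pair (`hW4`, eisenstein-p1's route H), plus the PUBLISHED named facts (Greenberg–Vatsal, Greenberg 4.1,
Perrin-Riou–Schneider, Perrin-Riou 1987, Mazur–Tate sigma, modularity, Hoffstein–Luo, Gross–Zagier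
I.7.3, GZK). NO unstated cyclotomic main conjecture (x1a link L10) is used: rank `0` by
`RankZeroPartner.statement_of_rankZeroDisplay`, rank `1` by `statement_of_KY_of_schneider_typeB`,
assembled by `bsdpOnClassX1_iff_statements`. (Compare `Rank1ResidualX1Defs.bsdpOnClassX1_of_typedInputs'`:
KY display + `MazurMainConjectureOnX1TypeA`; and x1b's `bsdpOnClassX1_of_mazurMC_typeA_of_schneider`:
`MazurMainConjectureOnX1TypeA` + Schneider on the whole rank-one leaf.) No label change.
[cite: KellerYin2024, Thms. 3.0.11, 7.0.6 and proof of Thm. 4.2.1 (p. 22) (announced; explicit hypotheses)]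
[cite: GreenbergVatsal2000, Thm. (1.3)] [cite: CastellaEtAl2021, Thms. 5.1.4, 5.3.1]
[cite: PerrinRiou1987, §1.4 Cor. 1.8] [cite: Schneider1985, §1] -/
theorem bsdpOnClassX1_of_KY_of_rankZeroDisplay_of_schneider
    (hKY : KellerYin2024.thm421_rankOne_display_OPEN) (hDisp : RankZeroPartner.RankZeroDisplay)
    (hW4 : ∀ (W : WeierstrassCurve ℚ) [W.IsElliptic] [W.IsGloballyMinimal] (p : ℕ) [Fact p.Prime],
      RankZero.Leaf W p → RankZeroPartner.SchneiderPartnerAt W p)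
    (hSchB : ∀ (W : WeierstrassCurve ℚ) [W.IsElliptic] [W.IsGloballyMinimal] (p : ℕ) [Fact p.Prime],
      Leaf W p → GVPar W p → ∀ Dh : PAdicHeightData W p, Dh.IsCanonical → SchneiderConjecture Dh)
    (hGV : GreenbergVatsal2000.thm13_charIdeal_eq_of_gvPar) (hGr : greenberg_charValue_rankZero)
    (hS : Schneider1985_order_charGenerator_odd) (hPR : perrinRiou_rankOne_leadingTerms_odd)
    (hMT : mazur_tate_sigma_exists_odd) (hmod : nonempty_modularParametrizationData)
    (hmod' : exists_isNewformOf) (hHL : HoffsteinLuo1997_exists_twist_L_one_ne_zero)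
    (hGZ : GrossZagier1986_thm_I_7_3) (hGZK : rank_eq_analyticRank_of_analyticRank_le_one) :
    BSDpOnClassX1 :=
  bsdpOnClassX1_iff_statements.mpr
    ⟨RankZeroPartner.statement_of_rankZeroDisplay hDisp hW4 hGV hS hPR hMT hmod hmod' hGZK,
      statement_of_KY_of_schneider_typeB hKY hSchB hGV hGr hS hPR hMT hmod hmod' hHL hGZ hGZK⟩

/-! ### §3. The covered neighbour at `r = 1` (by name) and the rank-one good-Eisenstein dichotomy -/

/-- **Off the leaf, a good Eisenstein pair `p > 2` of analytic rank `1` satisfies `BSD(E,p)` from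
PUBLISHED theorems.** At `r = 1` the class clause is vacuous, so "good, reducible, `p > 2`, off the
leaf" means NOT anomalous: covered row C6 (Castella–Grossi–Skinner, Math. Ann. 393 (2025) Thm. D, both
ranks `≤ 1`); tree `Rank1Residual.bsdp_of_not_classX1` (x1a gen 6, class-free, binder-free). Named
facts: `hD` (CGS Thm. D), `hGV`/`hGr` (only reached at `r = 0`), modularity (`hmod`, `hmodP`), GZK
(`hGZK`). [cite: CastellaGrossiSkinner2025, Theorem D] [cite: GreenbergVatsal2000, Thm. (1.3)] -/
theorem bsdp_of_not_leaf [W.IsElliptic]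
    (hD : CastellaGrossiSkinner2025.thmD_padicValRat_bsd_rank_le_one)
    (hGV : GreenbergVatsal2000.thm13_charIdeal_eq_of_gvPar) (hGr : greenberg_charValue_rankZero)
    (hmod : hasEntireLFunction_rat) (hmodP : nonempty_modularParametrizationData)
    (hGZK : rank_eq_analyticRank_of_analyticRank_le_one)
    (hp : 2 < p) (hgood : Good W p) (hred : Red W p) (hr1 : W.analyticRank = 1)
    (hnot : ¬ Leaf W p) : BSDp W p :=
  bsdp_of_not_classX1 hD hGV hGr hmod hmodP hGZK W p hp hgood hred hr1.le (fun hX1 ↦ hnot ⟨hX1, hr1⟩)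

/-- **The rank-one good-Eisenstein dichotomy of the published record:** at a good Eisenstein prime
`p > 2` of a curve of analytic rank `1`, EITHER `BSD(E,p)` holds by the published theorems (C6) OR the
pair is on this leaf. [cite: CastellaGrossiSkinner2025, Theorem D] -/
theorem bsdp_or_leaf [W.IsElliptic]
    (hD : CastellaGrossiSkinner2025.thmD_padicValRat_bsd_rank_le_one)
    (hGV : GreenbergVatsal2000.thm13_charIdeal_eq_of_gvPar) (hGr : greenberg_charValue_rankZero)
    (hmod : hasEntireLFunction_rat) (hmodP : nonempty_modularParametrizationData)
    (hGZK : rank_eq_analyticRank_of_analyticRank_le_one)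
    (hp : 2 < p) (hgood : Good W p) (hred : Red W p) (hr1 : W.analyticRank = 1) :
    BSDp W p ∨ Leaf W p := by
  by_cases hL : Leaf W p
  · exact Or.inr hL
  · exact Or.inl (bsdp_of_not_leaf hD hGV hGr hmod hmodP hGZK hp hgood hred hr1 hL)

/-- **What settling the rank-one leaf buys:** granted `Statement` (and the published facts), EVERY good
Eisenstein prime `p > 2` of EVERY elliptic curve over `ℚ` of analytic rank `1` satisfies `BSD(E,p)`.
[cite: CastellaGrossiSkinner2025, Theorem D] -/
theorem bsdp_goodEisenstein_rankOne_of_statement (hS : Statement)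
    (hD : CastellaGrossiSkinner2025.thmD_padicValRat_bsd_rank_le_one)
    (hGV : GreenbergVatsal2000.thm13_charIdeal_eq_of_gvPar) (hGr : greenberg_charValue_rankZero)
    (hmod : hasEntireLFunction_rat) (hmodP : nonempty_modularParametrizationData)
    (hGZK : rank_eq_analyticRank_of_analyticRank_le_one)
    (W : WeierstrassCurve ℚ) [W.IsElliptic] [W.IsGloballyMinimal] (p : ℕ) [Fact p.Prime]
    (hp : 2 < p) (hgood : Good W p) (hred : Red W p) (hr1 : W.analyticRank = 1) : BSDp W p :=
  (bsdp_or_leaf hD hGV hGr hmod hmodP hGZK hp hgood hred hr1).elim id (hS W p)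

/-- **Both leaves together settle the whole good-Eisenstein locus `p > 2`, `r_an ≤ 1`:** granted
`RankZero.Statement`, `Statement` and the PUBLISHED facts (CGS Thm. D, Greenberg–Vatsal, Greenberg
4.1, modularity, GZK), every good prime `p > 2` with `E[p]` reducible of every elliptic curve over `ℚ`
of analytic rank `≤ 1` satisfies `BSD(E,p)` (`Rank1Residual.bsdp_or_classX1` split by rank).
[cite: CastellaGrossiSkinner2025, Theorem D] [cite: GreenbergVatsal2000, Thm. (1.3)] -/
theorem bsdp_goodEisenstein_of_statements (h0 : RankZero.Statement) (h1 : Statement)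
    (hD : CastellaGrossiSkinner2025.thmD_padicValRat_bsd_rank_le_one)
    (hGV : GreenbergVatsal2000.thm13_charIdeal_eq_of_gvPar) (hGr : greenberg_charValue_rankZero)
    (hmod : hasEntireLFunction_rat) (hmodP : nonempty_modularParametrizationData)
    (hGZK : rank_eq_analyticRank_of_analyticRank_le_one)
    (W : WeierstrassCurve ℚ) [W.IsElliptic] [W.IsGloballyMinimal] (p : ℕ) [Fact p.Prime]
    (hp : 2 < p) (hgood : Good W p) (hred : Red W p) (hr : W.analyticRank ≤ 1) : BSDp W p := by
  by_cases hX1 : ClassX1 W p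
  · rcases rankZeroLeaf_or_leaf hX1 hr with hL | hL
    · exact h0 W p hL
    · exact h1 W p hL
  · exact bsdp_of_not_classX1 hD hGV hGr hmod hmodP hGZK W p hp hgood hred hr hX1

end Summit.BirchSwinnertonDyer.Rank1Residual.X1.RankOne

end
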